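import Summits.QuantumFields.BalabanUV.T4Continuum.Support.VariationalVectorGaugeSliceDist
import Summits.QuantumFields.BalabanUV.T4Continuum.Support.VariationalColourOneStepPhys
import Summits.QuantumFields.BalabanUV.T4Continuum.Support.VariationalColourScalarPair

/-!
# T⁴ programme, spine node NE2 (U1a), lane P2 — HARM-APPROX: THE INTERPOLATED COARSE `K`-HARMONIC IS ENERGY-CLOSE TO THE FINE `K′`-HARMONIC OF THE SAME
# UNIT DATUM — a COROLLARY of the scalar sector's one-step brackets (ONE⁺ competitor + FED⁺ lower bracket) by Pythagoras on the fine fibre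
# (item «V-ONE-G WITH BACKGROUND», file 2; model level; cell `pub-balaban`)

NE2 formalisation swarm `b2b-balaban-t4-ne2-formalise-*`, leaf prover 01 GEN 8 (`prover-b2b-balaban-t4-ne2-formalise-leaf-01-g8-0`); journal INTENT
CLAIMS.log 2026-08-20 l.18200, FINDING F-ne2leaf01g8-1 l.18526, memo `t4/T4-EST-NE2-P2-VONEG.md` v1 §4 (H).  File 1 of the item is
`VariationalVectorGaugeSliceDist` (`projG = dist²(div_R W, S_R(K)ᗮ)`, `S_R(K)ᗮ` = the scalar fibre-minimisers, Pythagoras on scalar fibres).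

WHY.  V-ONE-G for Bałaban's projected gauge functional needs, one level up, an element of the fine slice complement `S′ᗮ` close to the interpolated coarse
representative `Π_{Sᗮ}(div_R W₀)`.  By file 1, `Sᗮ` ∕ `S′ᗮ` are the minimiser spaces of the SCALAR covariant Dirichlet sum under the coarse ∕ composite block
averages; so the needed statement is: for a unit datum `ψ`, the coarse scalar minimiser `s` (level `n`), its one-step interpolant `j = J s` (in the composite fine
fibre of `ψ`) and the fine minimiser `u` (level `nL`, same datum) satisfy `Sf(j − u) ≤ e_H·‖ψ‖²` with `e_H` the scalar pair's one-step defect — HARM-APPROX.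
PROOF (abstract, §1 `harmApprox_energy`): Pythagoras on the fine fibre `Sf j = Sf u + Sf (j − u)`; the competitor bound (ONE⁺) `Sf j ≤ (√(Sc s + ε₁ρ s) + δ′√(qW s))²`;
the lower bracket at the fine minimiser through the coarse minimality of `s`: `Sc s ≤ Sc (Q₁ u) ≤ (√(Sf u) + δ√(qV u))²` (FED⁺), whence `Sc s − Sf u ≤ 2δ√(Sc s)√(qV u)`;
then REG⁺ ∕ P⁺ ∕ UB⁺ at `s` and fine P⁺ ∕ UB⁺ at `u` turn everything into multiples of `‖ψ‖²`:
    `Sf (j − u) ≤ e_H·‖ψ‖²`,  `e_H = ε₁C_R(Λ+1) + 2δ′√(C_P(Λ+1)(Λ + ε₁C_R(Λ+1))) + δ′²C_P(Λ+1) + 2δ√(Λ·C_P(Λ+1))`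
(§1 `harmApprox_energy`), and the fine P⁺ on the kernel element `j − u` gives the `ℓ²` form `qV (j − u) ≤ C_P·e_H·‖ψ‖²` (`harmApprox_mass`).
 * §1 abstract letters (any carriers; the leaves as displayed binders in the shapes of `VariationalCovariantAssemblySqrt.pair_bracket_sqrt`, plus the Pythagoras
   shape `hPyth` and the kernel-additivity of the composite average);
 * §2 colour letters (`Scv`∕`Sfv`∕`qWv`∕`qVv`∕`Qkv`∕`Q1v`∕`rhov`, `E`-valued 0-forms, operator transports): **`harmApprox_colour`** with ONE⁺ DISCHARGED by leaf-02-g4's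
   `VariationalColourOneStepPhys.Sfv_interpv_le` + `VariationalColourInterpolant.Qcv_interpv` (the competitor IS `interpv T′ Rc s`), FED⁺ DISCHARGED by
   `VariationalColourScalarPair.Scv_Q1v_le`, Pythagoras DISCHARGED by file 1's `sum_dirUv_eq_add_of_isMin`; UB⁺ ∕ P⁺ (both levels) ∕ REG⁺ stay DISPLAYED in the
   exact shapes of `VariationalColourTowerEndLocal.colour_pair_closed_local`'s internal `have`s (`hUBc_colour_rel`, `qWv_le_coarse_rel`, `qVv_le_composite_rel`,
   `hREG_rhov`), so that the holder of a data class closes them with the same four lines.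
Numerically (memo VONEG §2, taxi carriers, d = 2): the energy distance decays ∝ L^{−2k} and its `ℓ²` form ∝ L^{−4k}.

HONEST FRAMING (T4-DAG p. 1).  Composition of landed scalar-sector lemmas at MODEL level (transports ∕ site operators DATA, c5); [folklore]; nothing printed is a
hypothesis; no `def`, no `def … : Prop`, no `sorry`; axioms standard.  This is the SCALAR half of V-ONE-G only; V-ONE-G ∕ (ONE-min) with background NOT proved
here; V-END with background ∕ NE2 NOT proved; NE3 OPEN; spine PROVED 0∕9 unchanged; rung (B)+1 on a fixed finite T⁴ — NOT infinite volume, NOT mass gap, NOT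
Clay.  HONEST DEPENDENCY (cell, verbatim): continuum YM on T⁴ ⇐ BetaPertH ∧ nine spine estimates (0/9 proved); BetaPertH ⇐ (D1) ∧ (D4) ∧ CAP+tail; G-an2-4
gates asym, D1 and NE2/3/4.
-/

noncomputable section

namespace Summit.QuantumFields.BalabanUV.T4Continuum.VariationalHarmonicApprox

open Finset
open Literature.MathematicalPhysics.QuantumFieldTheory.Balaban1983to89.B5Prop11Plancherel (Tor fine unitVec)
open Literature.MathematicalPhysics.QuantumFieldTheory.Balaban1983to89.B5Block118 (bpt)
open Summit.QuantumFields.BalabanUV.T4Continuum.VariationalColourFederbush (cDv dirUv dirUv_nonneg Qcv misv)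
open Summit.QuantumFields.BalabanUV.T4Continuum.VariationalColourUpperBound (nsqv nsqv_nonneg)
open Summit.QuantumFields.BalabanUV.T4Continuum.VariationalColourInterpolant (interpv Qcv_interpv)
open Summit.QuantumFields.BalabanUV.T4Continuum.VariationalColourOneStepPhys (rhov rhov_nonneg Sfv_interpv_le)
open Summit.QuantumFields.BalabanUV.T4Continuum.VariationalColourScalarPair (Scv Sfv qWv qVv Qkv Q1v Scv_nonneg Sfv_nonneg qWv_nonneg qVv_nonneg Scv_Q1v_le)
open Summit.QuantumFields.BalabanUV.T4Continuum.VariationalColourDirichletForm (dformv dformv_smul_left sum_dirUv_add_smul Qcv_add_smul)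
open Summit.QuantumFields.BalabanUV.T4Continuum.VariationalVectorGaugeSliceDist (sum_dirUv_eq_add_of_isMin toLp_mem_orthogonal_iff_dformv projG_le_nsqv_sub)
open Summit.QuantumFields.BalabanUV.T4Continuum.VariationalVectorGaugeSlice (sliceSub projG)
open Summit.QuantumFields.BalabanUV.T4Continuum.VariationalVectorWeitzenbock (divV)
open Summit.QuantumFields.BalabanUV.T4Continuum.VariationalVectorGaugeSlice (avgOp avgOp_apply)

/-! ## §1 Abstract letters -/

section Abstract

variable {V W Z : Type*}

/-- `a − f ≤ 2δ√a·√q` from the lower bracket `a ≤ (√f + δ√q)²` (`0 ≤ a, f, q, δ`): if `√a ≤ δ√q` then `a ≤ δ√q·√a ≤ 2δ√a√q`; otherwise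
`f ≥ (√a − δ√q)²`. [folklore] -/
theorem sub_le_of_sqrt_bracket {a f q δ : ℝ} (ha : 0 ≤ a) (hf : 0 ≤ f) (hq : 0 ≤ q) (hδ : 0 ≤ δ)
    (h : a ≤ (Real.sqrt f + δ * Real.sqrt q) ^ 2) : a - f ≤ 2 * δ * Real.sqrt a * Real.sqrt q := by
  have hsa : Real.sqrt a ^ 2 = a := Real.sq_sqrt ha
  have hsf : Real.sqrt f ^ 2 = f := Real.sq_sqrt hf
  have hsq : Real.sqrt q ^ 2 = q := Real.sq_sqrt hq
  have h1 : Real.sqrt a ≤ Real.sqrt f + δ * Real.sqrt q := by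
    rw [← Real.sqrt_sq (by positivity : 0 ≤ Real.sqrt f + δ * Real.sqrt q)]
    exact Real.sqrt_le_sqrt h
  have hx0 : 0 ≤ δ * Real.sqrt a * Real.sqrt q := by positivity
  by_cases hc : δ * Real.sqrt q ≤ Real.sqrt a
  · -- square `√a − δ√q ≤ √f`
    have h2 : (Real.sqrt a - δ * Real.sqrt q) ^ 2 ≤ Real.sqrt f ^ 2 :=
      pow_le_pow_left₀ (by linarith) (by linarith) 2
    have e : (Real.sqrt a - δ * Real.sqrt q) ^ 2 = a - 2 * δ * Real.sqrt a * Real.sqrt q + δ ^ 2 * q := by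
      rw [sub_sq, hsa, mul_pow, hsq]; ring
    rw [hsf, e] at h2
    nlinarith [sq_nonneg δ]
  · -- `√a < δ√q`: `a = √a·√a ≤ δ√q·√a`
    have hc' : Real.sqrt a ≤ δ * Real.sqrt q := le_of_not_ge hc
    have h3 : a ≤ δ * Real.sqrt q * Real.sqrt a := by
      calc a = Real.sqrt a * Real.sqrt a := (Real.mul_self_sqrt ha).symm
        _ ≤ (δ * Real.sqrt q) * Real.sqrt a := mul_le_mul_of_nonneg_right hc' (Real.sqrt_nonneg a)
    nlinarith

/-- **HARM-APPROX, ENERGY FORM (abstract)**: coarse form `Sc`, fine form `Sf` (`≥ 0`), composite average `Qk ∘ Q₁`; a coarse fibre-minimiser `s` of datum `ψ`,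
a fine fibre-minimiser `u` of the same datum, and the one-step competitor `j` of `s` in the fine fibre with the ONE⁺ bound; the FED⁺ lower bracket at `u`;
Pythagoras on the fine fibre; UB⁺∕P⁺∕REG⁺ at `s`, fine P⁺∕UB⁺ at `u` ⟹ `Sf (j − u) ≤ e_H·qZ ψ`. [folklore] -/
theorem harmApprox_energy [AddCommGroup V] {Sc : W → ℝ} {Sf : V → ℝ} {Qk : W → Z} {Q₁ : V → W} {qW : W → ℝ} {qV : V → ℝ} {qZ : Z → ℝ} {ρ : W → ℝ}
    (hSc0 : ∀ f, 0 ≤ Sc f) (hSf0 : ∀ g, 0 ≤ Sf g) (hqW0 : ∀ f, 0 ≤ qW f) (hqV0 : ∀ g, 0 ≤ qV g) (hqZ0 : ∀ ψ, 0 ≤ qZ ψ) (hρ0 : ∀ f, 0 ≤ ρ f)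
    {Λ CP CR δ ε₁ δ' : ℝ} (hΛ : 0 ≤ Λ) (hCP : 0 ≤ CP) (hCR : 0 ≤ CR) (hδ : 0 ≤ δ) (hε₁ : 0 ≤ ε₁) (hδ' : 0 ≤ δ')
    -- the leaves, as displayed binders
    (hUBc : ∀ ψ, ∃ f, Qk f = ψ ∧ Sc f ≤ Λ * qZ ψ) (hUBf : ∀ ψ, ∃ g, Qk (Q₁ g) = ψ ∧ Sf g ≤ Λ * qZ ψ)
    (hPc : ∀ f, qW f ≤ CP * (Sc f + qZ (Qk f))) (hPf : ∀ g, qV g ≤ CP * (Sf g + qZ (Qk (Q₁ g))))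
    (hFED : ∀ g, Sc (Q₁ g) ≤ (Real.sqrt (Sf g) + δ * Real.sqrt (qV g)) ^ 2)
    (hREG : ∀ ψ f, Qk f = ψ → (∀ f₂, Qk f₂ = ψ → Sc f ≤ Sc f₂) → ρ f ≤ CR * (Sc f + qZ ψ))
    (hPyth : ∀ ψ u g, Qk (Q₁ u) = ψ → (∀ g₂, Qk (Q₁ g₂) = ψ → Sf u ≤ Sf g₂) → Qk (Q₁ g) = ψ → Sf g = Sf u + Sf (g - u))
    -- the data: datum, coarse minimiser, fine minimiser, competitor with the ONE⁺ bound
    {ψ : Z} {s : W} (hs : Qk s = ψ) (hsmin : ∀ f₂, Qk f₂ = ψ → Sc s ≤ Sc f₂)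
    {u : V} (hu : Qk (Q₁ u) = ψ) (humin : ∀ g₂, Qk (Q₁ g₂) = ψ → Sf u ≤ Sf g₂)
    {j : V} (hj : Qk (Q₁ j) = ψ) (hONE : Sf j ≤ (Real.sqrt (Sc s + ε₁ * ρ s) + δ' * Real.sqrt (qW s)) ^ 2) :
    Sf (j - u) ≤ (ε₁ * CR * (Λ + 1) + 2 * δ' * Real.sqrt ((Λ + ε₁ * CR * (Λ + 1)) * (CP * (Λ + 1))) + δ' ^ 2 * (CP * (Λ + 1))
        + 2 * δ * Real.sqrt (Λ * (CP * (Λ + 1)))) * qZ ψ := by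
  set A := Sc s with hA
  set F := Sf u with hF
  set z := qZ ψ with hz
  have hA0 : 0 ≤ A := hSc0 s
  have hF0 : 0 ≤ F := hSf0 u
  have hz0 : 0 ≤ z := hqZ0 ψ
  -- UB⁺ at both levels through minimality
  have hAΛ : A ≤ Λ * z := by obtain ⟨f, hf, hb⟩ := hUBc ψ; exact (hsmin f hf).trans hb
  have hFΛ : F ≤ Λ * z := by obtain ⟨g, hg, hb⟩ := hUBf ψ; exact (humin g hg).trans hb
  -- P⁺, REG⁺ at the coarse minimiser; fine P⁺ at the fine minimiser
  have hqW : qW s ≤ CP * (A + z) := by have := hPc s; rw [hs] at this; exact this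
  have hρ : ρ s ≤ CR * (A + z) := hREG ψ s hs hsmin
  have hqV : qV u ≤ CP * (F + z) := by have := hPf u; rw [hu] at this; exact this
  -- the lower bracket at `u` through the coarse minimality of `s`: `A ≤ Sc (Q₁ u) ≤ (√F + δ√qV u)²`
  have hlow : A ≤ (Real.sqrt F + δ * Real.sqrt (qV u)) ^ 2 := (hsmin (Q₁ u) hu).trans (hFED u)
  have hAF : A - F ≤ 2 * δ * Real.sqrt A * Real.sqrt (qV u) := sub_le_of_sqrt_bracket hA0 hF0 (hqV0 u) hδ hlow
  -- Pythagoras: `Sf (j − u) = Sf j − F`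
  have hP : Sf (j - u) = Sf j - F := by have := hPyth ψ u j hu humin hj; linarith
  -- sizes in terms of `z`
  have h1 : ε₁ * ρ s ≤ ε₁ * CR * (Λ + 1) * z := by
    calc ε₁ * ρ s ≤ ε₁ * (CR * (A + z)) := mul_le_mul_of_nonneg_left hρ hε₁
      _ ≤ ε₁ * (CR * (Λ * z + z)) := by gcongr
      _ = ε₁ * CR * (Λ + 1) * z := by ring
  have h2 : qW s ≤ CP * (Λ + 1) * z := by
    calc qW s ≤ CP * (A + z) := hqW
      _ ≤ CP * (Λ * z + z) := by gcongr
      _ = CP * (Λ + 1) * z := by ring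
  have h3 : qV u ≤ CP * (Λ + 1) * z := by
    calc qV u ≤ CP * (F + z) := hqV
      _ ≤ CP * (Λ * z + z) := by gcongr
      _ = CP * (Λ + 1) * z := by ring
  have h4 : A + ε₁ * ρ s ≤ (Λ + ε₁ * CR * (Λ + 1)) * z := by linarith
  have hsq1 : Real.sqrt (A + ε₁ * ρ s) ≤ Real.sqrt ((Λ + ε₁ * CR * (Λ + 1)) * z) := Real.sqrt_le_sqrt h4
  have hsq2 : Real.sqrt (qW s) ≤ Real.sqrt (CP * (Λ + 1) * z) := Real.sqrt_le_sqrt h2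
  have hsq3 : Real.sqrt (qV u) ≤ Real.sqrt (CP * (Λ + 1) * z) := Real.sqrt_le_sqrt h3
  have hsqA : Real.sqrt A ≤ Real.sqrt (Λ * z) := Real.sqrt_le_sqrt hAΛ
  -- expand the ONE⁺ square and collect
  have hONE' : Sf j ≤ A + ε₁ * ρ s + 2 * δ' * (Real.sqrt (A + ε₁ * ρ s) * Real.sqrt (qW s)) + δ' ^ 2 * qW s := by
    have e : (Real.sqrt (A + ε₁ * ρ s) + δ' * Real.sqrt (qW s)) ^ 2
        = Real.sqrt (A + ε₁ * ρ s) ^ 2 + 2 * δ' * (Real.sqrt (A + ε₁ * ρ s) * Real.sqrt (qW s)) + δ' ^ 2 * Real.sqrt (qW s) ^ 2 := by ring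
    rw [e, Real.sq_sqrt (by have := hρ0 s; positivity), Real.sq_sqrt (hqW0 s)] at hONE
    exact hONE
  have hx1 : Real.sqrt (A + ε₁ * ρ s) * Real.sqrt (qW s) ≤ Real.sqrt ((Λ + ε₁ * CR * (Λ + 1)) * (CP * (Λ + 1))) * z := by
    calc Real.sqrt (A + ε₁ * ρ s) * Real.sqrt (qW s) ≤ Real.sqrt ((Λ + ε₁ * CR * (Λ + 1)) * z) * Real.sqrt (CP * (Λ + 1) * z) :=
          mul_le_mul hsq1 hsq2 (Real.sqrt_nonneg _) (Real.sqrt_nonneg _)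
      _ = Real.sqrt ((Λ + ε₁ * CR * (Λ + 1)) * (CP * (Λ + 1))) * z := by
          rw [← Real.sqrt_mul (by positivity), show (Λ + ε₁ * CR * (Λ + 1)) * z * (CP * (Λ + 1) * z)
            = ((Λ + ε₁ * CR * (Λ + 1)) * (CP * (Λ + 1))) * (z * z) by ring, Real.sqrt_mul (by positivity), Real.sqrt_mul_self hz0]
  have hx2 : Real.sqrt A * Real.sqrt (qV u) ≤ Real.sqrt (Λ * (CP * (Λ + 1))) * z := by
    calc Real.sqrt A * Real.sqrt (qV u) ≤ Real.sqrt (Λ * z) * Real.sqrt (CP * (Λ + 1) * z) :=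
          mul_le_mul hsqA hsq3 (Real.sqrt_nonneg _) (Real.sqrt_nonneg _)
      _ = Real.sqrt (Λ * (CP * (Λ + 1))) * z := by
          rw [← Real.sqrt_mul (by positivity), show Λ * z * (CP * (Λ + 1) * z) = (Λ * (CP * (Λ + 1))) * (z * z) by ring,
            Real.sqrt_mul (by positivity), Real.sqrt_mul_self hz0]
  rw [hP]
  have hδ'2 : δ' ^ 2 * qW s ≤ δ' ^ 2 * (CP * (Λ + 1)) * z := by nlinarith [sq_nonneg δ']
  nlinarith [mul_le_mul_of_nonneg_left hx1 (by positivity : (0 : ℝ) ≤ 2 * δ'), mul_le_mul_of_nonneg_left hx2 (by positivity : (0 : ℝ) ≤ 2 * δ)]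

/-- **HARM-APPROX, `ℓ²` FORM (abstract)**: with the fine P⁺ on the KERNEL element `j − u` (`Qk (Q₁ (j − u)) = 0` by the additivity `hQsub` and `qZ 0 = 0`),
`qV (j − u) ≤ C_P·e_H·qZ ψ`. [folklore] -/
theorem harmApprox_mass [AddCommGroup V] [AddGroup Z] {Sc : W → ℝ} {Sf : V → ℝ} {Qk : W → Z} {Q₁ : V → W} {qW : W → ℝ} {qV : V → ℝ} {qZ : Z → ℝ}
    {ρ : W → ℝ}
    (hSc0 : ∀ f, 0 ≤ Sc f) (hSf0 : ∀ g, 0 ≤ Sf g) (hqW0 : ∀ f, 0 ≤ qW f) (hqV0 : ∀ g, 0 ≤ qV g) (hqZ0 : ∀ ψ, 0 ≤ qZ ψ) (hqZ00 : qZ 0 = 0)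
    (hρ0 : ∀ f, 0 ≤ ρ f)
    {Λ CP CR δ ε₁ δ' : ℝ} (hΛ : 0 ≤ Λ) (hCP : 0 ≤ CP) (hCR : 0 ≤ CR) (hδ : 0 ≤ δ) (hε₁ : 0 ≤ ε₁) (hδ' : 0 ≤ δ')
    (hUBc : ∀ ψ, ∃ f, Qk f = ψ ∧ Sc f ≤ Λ * qZ ψ) (hUBf : ∀ ψ, ∃ g, Qk (Q₁ g) = ψ ∧ Sf g ≤ Λ * qZ ψ)
    (hPc : ∀ f, qW f ≤ CP * (Sc f + qZ (Qk f))) (hPf : ∀ g, qV g ≤ CP * (Sf g + qZ (Qk (Q₁ g))))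
    (hFED : ∀ g, Sc (Q₁ g) ≤ (Real.sqrt (Sf g) + δ * Real.sqrt (qV g)) ^ 2)
    (hREG : ∀ ψ f, Qk f = ψ → (∀ f₂, Qk f₂ = ψ → Sc f ≤ Sc f₂) → ρ f ≤ CR * (Sc f + qZ ψ))
    (hPyth : ∀ ψ u g, Qk (Q₁ u) = ψ → (∀ g₂, Qk (Q₁ g₂) = ψ → Sf u ≤ Sf g₂) → Qk (Q₁ g) = ψ → Sf g = Sf u + Sf (g - u))
    (hQsub : ∀ g g', Qk (Q₁ (g - g')) = Qk (Q₁ g) - Qk (Q₁ g'))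
    {ψ : Z} {s : W} (hs : Qk s = ψ) (hsmin : ∀ f₂, Qk f₂ = ψ → Sc s ≤ Sc f₂)
    {u : V} (hu : Qk (Q₁ u) = ψ) (humin : ∀ g₂, Qk (Q₁ g₂) = ψ → Sf u ≤ Sf g₂)
    {j : V} (hj : Qk (Q₁ j) = ψ) (hONE : Sf j ≤ (Real.sqrt (Sc s + ε₁ * ρ s) + δ' * Real.sqrt (qW s)) ^ 2) :
    qV (j - u) ≤ CP * ((ε₁ * CR * (Λ + 1) + 2 * δ' * Real.sqrt ((Λ + ε₁ * CR * (Λ + 1)) * (CP * (Λ + 1))) + δ' ^ 2 * (CP * (Λ + 1))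
        + 2 * δ * Real.sqrt (Λ * (CP * (Λ + 1)))) * qZ ψ) := by
  have hE := harmApprox_energy hSc0 hSf0 hqW0 hqV0 hqZ0 hρ0 hΛ hCP hCR hδ hε₁ hδ' hUBc hUBf hPc hPf hFED hREG hPyth hs hsmin hu humin hj hONE
  have hker : Qk (Q₁ (j - u)) = 0 := by rw [hQsub, hj, hu, sub_self]
  have h := hPf (j - u)
  rw [hker, hqZ00, add_zero] at h
  exact h.trans (mul_le_mul_of_nonneg_left hE hCP)

end Abstract

/-! ## §2 Colour letters: ONE⁺, FED⁺ and Pythagoras DISCHARGED; UB⁺ ∕ P⁺ ∕ REG⁺ displayed in `colour_pair_closed_local`'s shapes -/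

section Colour

variable {d : ℕ} {E : Type*} [NormedAddCommGroup E] [InnerProductSpace ℂ E] [CompleteSpace E] [FiniteDimensional ℂ E]

/-! ### §2a First variation and Pythagoras on the fibre of ANY linear constraint map (the composite average is one) -/

omit [CompleteSpace E] [FiniteDimensional ℂ E] in
/-- **FIRST VARIATION on the fibre of a linear constraint** (leaf-02-g5's `dformv_eq_zero_of_isMin` with the transported block average replaced by an arbitrary
ℂ-linear map `Φ` — the composite average `Q_T ∘ Q_{T′}` is not itself a one-block `Qcv`, but it is linear): if `f` minimises `Σ_μ dirUv R` on `{g : Φ g = μ}` then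
`dformv R h f = 0` for every `h ∈ ker Φ`. [folklore] -/
theorem dformv_eq_zero_of_isMin_linear {N : Fin d → ℕ} [∀ μ, NeZero (N μ)] {Z' : Type*} [AddCommGroup Z'] [Module ℂ Z']
    (R : Tor N → Fin d → (E →L[ℂ] E)) (Φ : (Tor N → E) →ₗ[ℂ] Z') {μ : Z'} {f : Tor N → E} (hf : Φ f = μ)
    (hmin : ∀ g, Φ g = μ → ∑ ν, dirUv N R f ν ≤ ∑ ν, dirUv N R g ν) {h : Tor N → E} (hh : Φ h = 0) : dformv N R h f = 0 := by
  have hre : ∀ h' : Tor N → E, Φ h' = 0 → (dformv N R h' f).re = 0 := by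
    intro h' hh'
    set b : ℝ := (dformv N R h' f).re
    set c : ℝ := ∑ ν, dirUv N R h' ν
    have hc : 0 ≤ c := sum_nonneg fun ν _ => dirUv_nonneg _ _ _ _
    have hq : ∀ t : ℝ, 0 ≤ 2 * t * b + t ^ 2 * c := fun t => by
      have hfib : Φ (f + (t : ℂ) • h') = μ := by rw [map_add, map_smul, hh', smul_zero, add_zero, hf]
      have := hmin _ hfib
      rw [sum_dirUv_add_smul] at this
      linarith
    have hc1 : 0 < c + 1 := by linarith
    have h1 := hq (-b / (c + 1))
    have e : 2 * (-b / (c + 1)) * b + (-b / (c + 1)) ^ 2 * c = -(b ^ 2 * (c + 2)) / (c + 1) ^ 2 := by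
      field_simp; ring
    rw [e] at h1
    have h2 : b ^ 2 * (c + 2) ≤ 0 := by
      have := mul_nonneg h1 (le_of_lt (pow_pos hc1 2))
      rw [div_mul_cancel₀ _ (ne_of_gt (pow_pos hc1 2))] at this
      linarith
    nlinarith [sq_nonneg b]
  have h1 := hre h hh
  have h2 := hre (Complex.I • h) (by rw [map_smul, hh, smul_zero])
  rw [dformv_smul_left, Complex.conj_I] at h2
  have him : (dformv N R h f).im = 0 := by
    have : (-Complex.I * dformv N R h f).re = (dformv N R h f).im := by simp [Complex.mul_re]
    rw [← this]; exact h2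
  exact Complex.ext h1 him

omit [CompleteSpace E] [FiniteDimensional ℂ E] in
/-- **PYTHAGORAS on the fibre of a linear constraint**: a fibre-minimiser `u` and any fibre element `g` satisfy
`Σ dirUv R g = Σ dirUv R u + Σ dirUv R (g − u)`. [folklore] -/
theorem sum_dirUv_eq_add_of_isMin_linear {N : Fin d → ℕ} [∀ μ, NeZero (N μ)] {Z' : Type*} [AddCommGroup Z'] [Module ℂ Z']
    (R : Tor N → Fin d → (E →L[ℂ] E)) (Φ : (Tor N → E) →ₗ[ℂ] Z') {μ : Z'} {u : Tor N → E} (hu : Φ u = μ)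
    (hmin : ∀ g, Φ g = μ → ∑ ν, dirUv N R u ν ≤ ∑ ν, dirUv N R g ν) {g : Tor N → E} (hg : Φ g = μ) :
    ∑ ν, dirUv N R g ν = ∑ ν, dirUv N R u ν + ∑ ν, dirUv N R (g - u) ν := by
  have hker : Φ (g - u) = 0 := by rw [map_sub, hg, hu, sub_self]
  have hz : dformv N R (g - u) u = 0 := dformv_eq_zero_of_isMin_linear R Φ hu hmin hker
  have e := sum_dirUv_add_smul N R u (g - u) 1
  rw [Complex.ofReal_one, one_smul, add_sub_cancel, hz, Complex.zero_re, mul_zero, add_zero, one_pow, one_mul] at e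
  exact e

omit [FiniteDimensional ℂ E] in
/-- **THE SLICE COMPLEMENT OF `K = ker Φ` FOR ANY LINEAR CONSTRAINT MAP** (file 1's `toLp_mem_orthogonal_iff_isMin` with `Q_T` replaced by a linear `Φ`, e.g. the
composite average): `toLp s ∈ S_R(ker Φ)ᗮ` iff `s` minimises `Σ_μ dirUv R` on `{g : Φ g = Φ s}`. [folklore] -/
theorem toLp_mem_orthogonal_iff_isMin_linear {N : Fin d → ℕ} [∀ μ, NeZero (N μ)] {Z' : Type*} [AddCommGroup Z'] [Module ℂ Z']
    (R : Tor N → Fin d → (E →L[ℂ] E)) (Φ : (Tor N → E) →ₗ[ℂ] Z') (s : Tor N → E) :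
    WithLp.toLp 2 s ∈ (sliceSub N R (LinearMap.ker Φ))ᗮ ↔ ∀ g, Φ g = Φ s → ∑ ν, dirUv N R s ν ≤ ∑ ν, dirUv N R g ν := by
  rw [toLp_mem_orthogonal_iff_dformv]
  constructor
  · intro h g hg
    have hker : Φ (g - s) = 0 := by rw [map_sub, hg, sub_self]
    have hz : dformv N R (g - s) s = 0 := h (g - s) (LinearMap.mem_ker.mpr hker)
    have e := sum_dirUv_add_smul N R s (g - s) 1
    rw [Complex.ofReal_one, one_smul, add_sub_cancel, hz, Complex.zero_re, mul_zero, add_zero, one_pow, one_mul] at e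
    rw [e]
    exact le_add_of_nonneg_right (sum_nonneg fun ν _ => dirUv_nonneg _ _ _ _)
  · intro hmin f hf
    exact dformv_eq_zero_of_isMin_linear R Φ rfl hmin (LinearMap.mem_ker.mp hf)

/-- **`projG` AGAINST ANY SCALAR MINIMISER OF A LINEAR-CONSTRAINT FIBRE**: `projG R (ker Φ) V ≤ Σ_x‖div_R V x − u x‖²` for every fibre-minimiser `u` of
`Σ dirUv R` under `Φ` (any datum) — the form V-ONE-G consumes at the FINE level, where `Φ` is the composite average. [folklore] -/
theorem projG_le_nsqv_sub_of_isMin_linear {N : Fin d → ℕ} [∀ μ, NeZero (N μ)] {Z' : Type*} [AddCommGroup Z'] [Module ℂ Z']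
    (R : Tor N → Fin d → (E →L[ℂ] E)) (Φ : (Tor N → E) →ₗ[ℂ] Z') (V : Tor N → Fin d → E) {ψ : Z'} {u : Tor N → E} (hu : Φ u = ψ)
    (hmin : ∀ g, Φ g = ψ → ∑ ν, dirUv N R u ν ≤ ∑ ν, dirUv N R g ν) :
    projG N R (LinearMap.ker Φ) V ≤ ∑ x, ‖divV N R V x - u x‖ ^ 2 := by
  refine projG_le_nsqv_sub N R _ V ((toLp_mem_orthogonal_iff_isMin_linear R Φ u).mpr fun g hg => hmin g ?_)
  rw [hg, hu]

/-! ### §2b HARM-APPROX in the colour letters -/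

variable (n L : ℕ) [NeZero n] [NeZero L] (M : Fin d → ℕ) [hM : ∀ μ, NeZero (M μ)]

omit [CompleteSpace E] [FiniteDimensional ℂ E] [NeZero n] [NeZero L] hM in
/-- the composite colour average is additive (both averagings are ℂ-linear). [folklore] -/
theorem Qkv_Q1v_sub (T : Tor (fine n M) → (E →L[ℂ] E)) (T' : Tor (fine L (fine n M)) → (E →L[ℂ] E)) (g g' : Tor (fine L (fine n M)) → E) :
    Qkv n M T (Q1v n L M T' (g - g')) = Qkv n M T (Q1v n L M T' g) - Qkv n M T (Q1v n L M T' g') := by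
  change avgOp n M T (avgOp L (fine n M) T' (g - g')) = avgOp n M T (avgOp L (fine n M) T' g) - avgOp n M T (avgOp L (fine n M) T' g')
  rw [map_sub, map_sub]

omit [CompleteSpace E] [FiniteDimensional ℂ E] in
/-- **PYTHAGORAS FOR THE COMPOSITE COLOUR FIBRE in physical units**: `Sfv g = Sfv u + Sfv (g − u)` for a minimiser `u` of `Sfv` on `{Qkv T (Q1v T′ ·) = ψ}` and
`g` in the same fibre. [folklore] -/
theorem Sfv_eq_add_of_isMin (T : Tor (fine n M) → (E →L[ℂ] E)) (T' : Tor (fine L (fine n M)) → (E →L[ℂ] E))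
    (R' : Tor (fine L (fine n M)) → Fin d → (E →L[ℂ] E)) {ψ : Tor M → E} {u : Tor (fine L (fine n M)) → E}
    (hu : Qkv n M T (Q1v n L M T' u) = ψ) (humin : ∀ g₂, Qkv n M T (Q1v n L M T' g₂) = ψ → Sfv n L M R' u ≤ Sfv n L M R' g₂)
    {g : Tor (fine L (fine n M)) → E} (hg : Qkv n M T (Q1v n L M T' g) = ψ) :
    Sfv n L M R' g = Sfv n L M R' u + Sfv n L M R' (g - u) := by
  have hc : 0 < ((n : ℝ) * L) ^ 2 / ((n : ℝ) * L) ^ d := by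
    have : (0 : ℝ) < n := by exact_mod_cast Nat.pos_of_ne_zero (NeZero.ne n)
    have : (0 : ℝ) < L := by exact_mod_cast Nat.pos_of_ne_zero (NeZero.ne L)
    positivity
  set Φ : (Tor (fine L (fine n M)) → E) →ₗ[ℂ] (Tor M → E) := (avgOp n M T).comp (avgOp L (fine n M) T') with hΦ
  have hΦapp : ∀ g', Φ g' = Qkv n M T (Q1v n L M T' g') := fun g' => rfl
  have humin' : ∀ g₂, Φ g₂ = ψ → ∑ ν, dirUv (fine L (fine n M)) R' u ν ≤ ∑ ν, dirUv (fine L (fine n M)) R' g₂ ν := by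
    intro g₂ hg₂
    have h := humin g₂ (by rw [← hΦapp]; exact hg₂)
    unfold Sfv at h
    exact le_of_mul_le_mul_left h hc
  have e := sum_dirUv_eq_add_of_isMin_linear R' Φ (μ := ψ) (by rw [hΦapp]; exact hu) humin' (g := g) (by rw [hΦapp]; exact hg)
  unfold Sfv
  rw [e, mul_add]

omit [FiniteDimensional ℂ E] in
/-- **HARM-APPROX IN THE COLOUR LETTERS** (model level; `E` a finite-dimensional Hilbert space; ONE⁺, FED⁺, Pythagoras DISCHARGED; UB⁺ ∕ P⁺ ∕ REG⁺ DISPLAYED in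
the shapes of `colour_pair_closed_local`'s `have`s): for a unit datum `ψ`, a coarse fibre-minimiser `s` of `Scv` under `Qkv T`, a fine fibre-minimiser `u` of `Sfv`
under the composite `Qkv T ∘ Q1v T′`, and the scalar one-step interpolant `j := interpv T′ Rc s` (IN the composite fibre by `Qcv_interpv`):
`Sfv (j − u) ≤ e_H·nsqv ψ` and `qVv (j − u) ≤ C_P·e_H·nsqv ψ` with
`e_H = ε₁C_R(Λ+1) + 2δ′√((Λ + ε₁C_R(Λ+1))·C_P(Λ+1)) + δ′²C_P(Λ+1) + 2δ√(Λ·C_P(Λ+1))`, `ε₁ = (d∕4 + 1∕2)·L∕n²`, `δ′ = √(2d(1+d²))·(nLm₁)`, `δ = √d·(nm)` —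
exactly the colour pair's one-step defect `e′ + (2δ-part of e)`. [folklore] -/
theorem harmApprox_colour {Rc : Tor (fine n M) → Fin d → (E →L[ℂ] E)} {R' : Tor (fine L (fine n M)) → Fin d → (E →L[ℂ] E)}
    {T : Tor (fine n M) → (E →L[ℂ] E)} {T' : Tor (fine L (fine n M)) → (E →L[ℂ] E)}
    (hT' : ∀ x, T' x ∈ unitary (E →L[ℂ] E)) (hRc : ∀ y μ, Rc y μ ∈ unitary (E →L[ℂ] E)) (hR' : ∀ x μ, ‖R' x μ‖ ≤ 1)
    -- FED⁺ data: one-block transport mismatch `m`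
    {m : ℝ} (hm : 0 ≤ m) (hmis : ∀ y μ j, ‖misv L (fine n M) Rc R' T' y μ j‖ ≤ m)
    -- ONE⁺ data: in-block ∕ crossing frame defects `m₁`
    {m₁ : ℝ} (hm₁ : 0 ≤ m₁)
    (hin : ∀ (y : Tor (fine n M)) (j : Fin d → Fin L) (μ : Fin d), (j μ : ℕ) + 1 < L →
      ‖R' (bpt L (fine n M) y j) μ * star (T' (bpt L (fine n M) y j + unitVec (fine L (fine n M)) μ)) - star (T' (bpt L (fine n M) y j))‖ ≤ m₁)
    (hcross : ∀ (y : Tor (fine n M)) (j : Fin d → Fin L) (μ : Fin d), (j μ : ℕ) + 1 = L →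
      ‖R' (bpt L (fine n M) y j) μ * star (T' (bpt L (fine n M) y j + unitVec (fine L (fine n M)) μ))
        - star (T' (bpt L (fine n M) y j)) * Rc y μ‖ ≤ m₁)
    -- the displayed leaves UB⁺ (both levels), P⁺ (both levels), REG⁺
    {Λ CP CR : ℝ} (hΛ : 0 ≤ Λ) (hCP : 0 ≤ CP) (hCR : 0 ≤ CR)
    (hUBc : ∀ ψ : Tor M → E, ∃ f, Qkv n M T f = ψ ∧ Scv n M Rc f ≤ Λ * nsqv ψ)
    (hUBf : ∀ ψ : Tor M → E, ∃ g, Qkv n M T (Q1v n L M T' g) = ψ ∧ Sfv n L M R' g ≤ Λ * nsqv ψ)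
    (hPc : ∀ f, qWv n M f ≤ CP * (Scv n M Rc f + nsqv (Qkv n M T f)))
    (hPf : ∀ g, qVv n L M g ≤ CP * (Sfv n L M R' g + nsqv (Qkv n M T (Q1v n L M T' g))))
    (hREG : ∀ (ψ : Tor M → E) f, Qkv n M T f = ψ → (∀ f₂, Qkv n M T f₂ = ψ → Scv n M Rc f ≤ Scv n M Rc f₂) →
      rhov n M Rc f ≤ CR * (Scv n M Rc f + nsqv ψ))
    -- the data: datum, coarse and fine minimisers
    {ψ : Tor M → E} {s : Tor (fine n M) → E} (hs : Qkv n M T s = ψ) (hsmin : ∀ f₂, Qkv n M T f₂ = ψ → Scv n M Rc s ≤ Scv n M Rc f₂)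
    {u : Tor (fine L (fine n M)) → E} (hu : Qkv n M T (Q1v n L M T' u) = ψ)
    (humin : ∀ g₂, Qkv n M T (Q1v n L M T' g₂) = ψ → Sfv n L M R' u ≤ Sfv n L M R' g₂) :
    let ε₁ : ℝ := ((d : ℝ) / 4 + 1 / 2) * ((L : ℝ) / (n : ℝ) ^ 2)
    let δ' : ℝ := Real.sqrt (2 * d * (1 + (d : ℝ) ^ 2)) * ((n : ℝ) * L * m₁)
    let δ : ℝ := Real.sqrt d * ((n : ℝ) * m)
    let eH : ℝ := ε₁ * CR * (Λ + 1) + 2 * δ' * Real.sqrt ((Λ + ε₁ * CR * (Λ + 1)) * (CP * (Λ + 1))) + δ' ^ 2 * (CP * (Λ + 1))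
      + 2 * δ * Real.sqrt (Λ * (CP * (Λ + 1)))
    Sfv n L M R' (interpv L (fine n M) T' Rc s - u) ≤ eH * nsqv ψ ∧ qVv n L M (interpv L (fine n M) T' Rc s - u) ≤ CP * (eH * nsqv ψ) := by
  intro ε₁ δ' δ eH
  have hε₁ : 0 ≤ ε₁ := by positivity
  have hδ' : 0 ≤ δ' := by positivity
  have hδ : 0 ≤ δ := by positivity
  have hT1 : ∀ x, ‖T' x‖ ≤ 1 := fun x => VariationalColourFederbush.norm_le_one_of_mem_unitary (hT' x)
  -- the competitor: in the composite fibre (`Qcv_interpv`) with the ONE⁺ bound (`Sfv_interpv_le`)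
  have hQ1j : Q1v n L M T' (interpv L (fine n M) T' Rc s) = s := Qcv_interpv L (fine n M) Rc s hT'
  have hj : Qkv n M T (Q1v n L M T' (interpv L (fine n M) T' Rc s)) = ψ := by rw [hQ1j, hs]
  have hONE : Sfv n L M R' (interpv L (fine n M) T' Rc s) ≤ (Real.sqrt (Scv n M Rc s + ε₁ * rhov n M Rc s) + δ' * Real.sqrt (qWv n M s)) ^ 2 := by
    have h := Sfv_interpv_le n L M hT' hRc hm₁ hin hcross s
    have e1 : ((d : ℝ) / 4 + 1 / 2) * ((L : ℝ) / (n : ℝ) ^ 2) * rhov n M Rc s = ε₁ * rhov n M Rc s := rfl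
    rw [e1] at h
    exact h
  -- FED⁺
  have hFED : ∀ g, Scv n M Rc (Q1v n L M T' g) ≤ (Real.sqrt (Sfv n L M R' g) + δ * Real.sqrt (qVv n L M g)) ^ 2 := fun g =>
    Scv_Q1v_le n L M hR' hT1 hm hmis g
  -- Pythagoras on the composite fibre
  have hPyth : ∀ (ψ' : Tor M → E) (u' g : Tor (fine L (fine n M)) → E), Qkv n M T (Q1v n L M T' u') = ψ' →
      (∀ g₂, Qkv n M T (Q1v n L M T' g₂) = ψ' → Sfv n L M R' u' ≤ Sfv n L M R' g₂) → Qkv n M T (Q1v n L M T' g) = ψ' →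
      Sfv n L M R' g = Sfv n L M R' u' + Sfv n L M R' (g - u') := fun ψ' u' g hu' hmin' hg => Sfv_eq_add_of_isMin n L M T T' R' hu' hmin' hg
  have hE := harmApprox_energy (V := Tor (fine L (fine n M)) → E) (W := Tor (fine n M) → E) (Z := Tor M → E)
    (Sc := Scv n M Rc) (Sf := Sfv n L M R') (Qk := Qkv n M T) (Q₁ := Q1v n L M T') (qW := qWv n M) (qV := qVv n L M) (qZ := nsqv) (ρ := rhov n M Rc)
    (Scv_nonneg n M Rc) (Sfv_nonneg n L M R') (qWv_nonneg n M) (qVv_nonneg n L M) nsqv_nonneg (rhov_nonneg n M Rc)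
    hΛ hCP hCR hδ hε₁ hδ' hUBc hUBf hPc hPf hFED hREG hPyth hs hsmin hu humin hj hONE
  have hker : Qkv n M T (Q1v n L M T' (interpv L (fine n M) T' Rc s - u)) = 0 := by rw [Qkv_Q1v_sub, hj, hu, sub_self]
  refine ⟨hE, ?_⟩
  have h := hPf (interpv L (fine n M) T' Rc s - u)
  rw [hker] at h
  have h0 : nsqv (0 : Tor M → E) = 0 := by unfold nsqv; simp
  rw [h0, add_zero] at h
  exact h.trans (mul_le_mul_of_nonneg_left hE hCP)

end Colour

end Summit.QuantumFields.BalabanUV.T4Continuum.VariationalHarmonicApprox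

end
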